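import Summits.NavierStokesRegularity.FunctionalMining.TopEigSaturatingModuli
import Summits.NavierStokesRegularity.FunctionalMining.TopEigHeatCoercive
import HarnessLib

/-!
# FunctionalMining — the `λ₁` / `−λ₃` moments pass the HEAT SIEVE: `TopEigHeatCoercive q 0`

Search for candidate a priori estimates; no regularity claim. Cell `pub-nsfunc`, prove seat
(gen 17). The dictionary's rate-`0` node `HeatCoercive Φ 0` is "exactly the (static) heat sieve"
(`heatCoercive_zero_iff`, `TopEigHeatCoercive.lean`; SIEVELD §1): `0 ≤ heatDissipation Φ v` for every
smooth zero-mean divergence-free `v`, i.e. the right derivative of `t ↦ Φ(v + tΔv)` at `0` is `≤ 0`.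
For the convex cores this is "Jensen" on paper (SIEVELD §0 Lemma 0, prose). Kernel proof here for every
ADMISSIBLE density `g` (convex, `1`-Lipschitz, `g ≥ 0` on divergence-free strains) and `Φ = ∫ g(S)^q`,
`q ≥ 1`, WITHOUT the heat semigroup and without differentiating the non-smooth functional: for the
mollified weight `W_ε`, `φ_ε(t) = F_ε(v + tΔv)` is differentiable with
`φ_ε'(t) = ∫ DW_ε(S_t)[ΔS]`, `S_t = S + tΔS`; since `ΔS = ΔS_t − tΔ²S`, the gen-16 viscous sign lemma
(`ConvexWeight.integral_fderiv_laplacian_nonpos`, convexity of `W_ε`) and `‖DW_ε‖ ≤ q g̃^{q−1}` give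
`φ_ε'(t) ≤ C t` on `[0, 1]` uniformly in `ε ≤ 1`, so `φ_ε(τ) − φ_ε(0) ≤ C τ²`, and `ε → 0` (sandwich)
gives `Φ(v + τΔv) − Φ(v) ≤ Cτ²`; hence `rightDeriv ≤ 0` (`TopEig.heatDissipation_eq_neg_rightDeriv`):

* `TopEig.heatDissipation_nonneg_of_admissible`, and the rows `TopEig.topEigHeatCoercive_zero :
  TopEigHeatCoercive q 0`, `TopEig.negBotEigHeatCoercive_zero` (every real `q ≥ 1`).

With `TopEigHeatCoerciveRate` (`c ≤ 4π²q`) the admissible rates of Lemma L-λ(q) form a sub-interval of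
`[0, 4π²q]` containing `0`; L-λ asks whether it contains a positive number. [ours]
-/

noncomputable section

open MeasureTheory Set Filter Topology Finset
open scoped InnerProductSpace RealInnerProductSpace ContDiff

namespace Summit.NavierStokesRegularity.FunctionalMining

open Literature.Analysis.FunctionSpaces Literature.Analysis.FluidPDE

namespace TopEig

open StrainL4 StrainMoment VorticityL4 StrainTensor

/-! ## 1. The heat-line strain as a space–time field -/

/-- The affine space–time field `(t, y) ↦ A y + t • B y` of two smooth fields is jointly smooth on every
time set. [folklore] -/
theorem isSmoothSpaceTimeOn_affine {d : Type*} [Fintype d] {E : Type*} [NormedAddCommGroup E]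
    [NormedSpace ℝ E] {A B : UnitAddTorus d → E} (hA : Torus.IsSmooth A) (hB : Torus.IsSmooth B)
    (S : Set ℝ) : Torus.IsSmoothSpaceTimeOn S (fun t y => A y + t • B y) := by
  refine Torus.isSmoothSpaceTimeOn_of_contDiff ?_ S
  have h : Torus.stLift (fun t y => A y + t • B y) =
      fun z : ℝ × EuclideanSpace ℝ d => Torus.lift A z.2 + z.1 • Torus.lift B z.2 := by
    funext z; rfl
  rw [h]
  unfold Torus.IsSmooth at hA hB
  exact (hA.comp contDiff_snd).add (contDiff_fst.smul (hB.comp contDiff_snd))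

/-- The time derivative of the affine field within `[a, b]` is `B`. [folklore] -/
theorem timeDerivWithin_affine {d : Type*} [Fintype d] {E : Type*} [NormedAddCommGroup E]
    [NormedSpace ℝ E] (A B : UnitAddTorus d → E) {a b t : ℝ} (hab : a < b) (ht : t ∈ Icc a b)
    (y : UnitAddTorus d) :
    Torus.timeDerivWithin (Icc a b) (fun s z => A z + s • B z) t y = B y := by
  unfold Torus.timeDerivWithin
  have h : HasDerivAt (fun s : ℝ => A y + s • B y) (B y) t := by
    have h1 := ((hasDerivAt_id t).smul_const (B y)).const_add (A y)
    simpa using h1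
  exact h.hasDerivWithinAt.derivWithin (uniqueDiffOn_Icc hab t ht)

/-! ## 2. `Φ(v + τΔv) − Φ(v) ≤ C τ²` -/

/-- **Second-order flatness of the heat line from above**: for an admissible-type density `g` (convex,
`1`-Lipschitz, `≥ 0` on divergence-free strains), `q ≥ 1`, `Φ = ∫ g(S)^q` on smooth divergence-free
fields and a smooth divergence-free `v`, there is `C` with `Φ(v + τΔv) − Φ(v) ≤ C τ²` for
`0 < τ ≤ 1`. [ours] -/
theorem heatLine_sub_le_sq {q : ℝ} (hq : 1 ≤ q)
    {g : EuclideanSpace ℝ (Fin 3 × Fin 3) → ℝ} (hconv : ConvexOn ℝ univ g) (hlip : LipschitzWith 1 g)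
    (hg0 : ∀ v : UnitAddTorus (Fin 3) → EuclideanSpace ℝ (Fin 3), Torus.IsSmooth v →
      Torus.IsDivFree v → ∀ x, 0 ≤ g (strainFlat v x))
    {Φ : (UnitAddTorus (Fin 3) → EuclideanSpace ℝ (Fin 3)) → ℝ}
    (hΦ : ∀ v : UnitAddTorus (Fin 3) → EuclideanSpace ℝ (Fin 3), Torus.IsSmooth v →
      Torus.IsDivFree v → Φ v = ∫ x, g (strainFlat v x) ^ q)
    {v : UnitAddTorus (Fin 3) → EuclideanSpace ℝ (Fin 3)} (hv : Torus.IsSmooth v)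
    (hdiv : Torus.IsDivFree v) :
    ∃ C : ℝ, ∀ τ : ℝ, 0 < τ → τ ≤ 1 → Φ (v + τ • Torus.laplacian v) - Φ v ≤ C * τ ^ 2 := by
  have hq0 : 0 < q := by linarith
  have hgc : Continuous g := hlip.continuous
  -- the strain `A = S_v`, its Laplacian `B = ΔS_v`, and `Δ B`
  set A : UnitAddTorus (Fin 3) → EuclideanSpace ℝ (Fin 3 × Fin 3) := strainFlat v with hAdef
  set B : UnitAddTorus (Fin 3) → EuclideanSpace ℝ (Fin 3 × Fin 3) := Torus.laplacian (strainFlat v)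
    with hBdef
  have hA : Torus.IsSmooth A := isSmooth_strainFlat hv
  have hB : Torus.IsSmooth B := hA.laplacian
  -- the heat-line strain as a space–time field on `[0, 1]`
  have h01 : (0 : ℝ) < 1 := one_pos
  set θ : ℝ → UnitAddTorus (Fin 3) → EuclideanSpace ℝ (Fin 3 × Fin 3) := fun t y => A y + t • B y
    with hθdef
  have hθ : Torus.IsSmoothSpaceTimeOn (Icc 0 1) θ := isSmoothSpaceTimeOn_affine hA hB _
  have hθeq : ∀ t y, θ t y = strainFlat (v + t • Torus.laplacian v) y := fun t y => by
    rw [strainFlat_heatLine hv t y]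
  have hθt : ∀ t, Torus.IsSmooth (θ t) := fun t => hA.add (hB.const_smul t)
  -- `g ≥ 0` along the heat line, so `θ t y ∈ U_φ` for every bump
  have hg0θ : ∀ t y, 0 ≤ g (θ t y) := fun t y => by
    rw [hθeq]
    exact hg0 _ (isSmooth_heatLine hv t)
      (isDivFree_add_smul hv hv.laplacian hdiv (isDivFree_laplacian hv hdiv) t) y
  -- uniform bounds: `g(θ t y) ≤ G` on `[0,1]`, `‖Δ B‖ ≤ M`
  obtain ⟨G, hG0, hG⟩ := exists_abs_comp_le hθ hgc isCompact_Icc subset_rfl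
  obtain ⟨M, hM⟩ : ∃ M : ℝ, ∀ y, ‖Torus.laplacian B y‖ ≤ M := by
    obtain ⟨M, hM⟩ := isCompact_univ.exists_bound_of_continuousOn hB.laplacian.continuous.continuousOn
    exact ⟨M, fun y => hM y (mem_univ y)⟩
  have hM0 : 0 ≤ M := (norm_nonneg _).trans (hM 0)
  -- the constants
  set C₁ : ℝ := q * (G + 3) ^ (q - 1) * M with hC₁
  set C₂ : ℝ := q * (G + 3) ^ (q - 1) * 3 with hC₂
  have hC₁0 : 0 ≤ C₁ := by
    rw [hC₁]; exact mul_nonneg (mul_nonneg hq0.le (Real.rpow_nonneg (by linarith) _)) hM0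
  have hC₂0 : 0 ≤ C₂ := by
    rw [hC₂]; exact mul_nonneg (mul_nonneg hq0.le (Real.rpow_nonneg (by linarith) _)) (by norm_num)
  refine ⟨C₁, fun τ hτ hτ1 => ?_⟩
  -- `Φ` along the heat line, in integral form
  set f : ℝ → ℝ := fun t => ∫ y, g (θ t y) ^ q with hf
  have hfΦ : ∀ t, Φ (v + t • Torus.laplacian v) = f t := by
    intro t
    rw [hΦ _ (isSmooth_heatLine hv t)
      (isDivFree_add_smul hv hv.laplacian hdiv (isDivFree_laplacian hv hdiv) t)]
    exact integral_congr_ae (ae_of_all _ fun y => by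
      show g (strainFlat (v + t • Torus.laplacian v) y) ^ q = g (θ t y) ^ q
      rw [hθeq])
  have hv0 : v + (0 : ℝ) • Torus.laplacian v = v := by simp
  have e0 : Φ v = f 0 := by
    have h := hfΦ 0
    rwa [hv0] at h
  rw [hfΦ τ, e0]
  -- for every `ε`: `f τ - f 0 ≤ F_ε τ - F_ε 0 + C₂ ε ≤ C₁ τ² + C₂ ε`
  refine le_of_forall_pos_le_add fun η hη => ?_
  set ε : ℝ := min 1 (η / (C₂ + 1)) with hεdef
  have hε : 0 < ε := lt_min one_pos (div_pos hη (by linarith))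
  have hε1 : ε ≤ 1 := min_le_left _ _
  have hεη : C₂ * ε ≤ η := by
    have h1 : ε ≤ η / (C₂ + 1) := min_le_right _ _
    have h2 : C₂ * ε ≤ C₂ * (η / (C₂ + 1)) := mul_le_mul_of_nonneg_left h1 hC₂0
    have h3 : C₂ * (η / (C₂ + 1)) ≤ η := by
      rw [mul_div_assoc']
      rw [div_le_iff₀ (by linarith)]
      nlinarith
    linarith
  set φ := bumpOf ε hε with hφ
  have hr : φ.rOut = ε := bumpOf_rOut ε hε
  set W : EuclideanSpace ℝ (Fin 3 × Fin 3) → ℝ := weight φ g q with hW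
  have hUo : IsOpen (posSet φ g) := isOpen_posSet φ hgc
  have hmaps : ∀ s ∈ Icc (0 : ℝ) 1, ∀ y, θ s y ∈ posSet φ g := fun s _ y =>
    (mem_posSet_of_nonneg φ hlip (hg0θ s y)).1
  have hW1 : ContDiffOn ℝ 1 W (posSet φ g) := contDiffOn_weight φ hgc q (by norm_cast)
  have hW2 : ContDiffOn ℝ 2 W (posSet φ g) := contDiffOn_weight φ hgc q (by norm_cast)
  set Fε : ℝ → ℝ := fun t => ∫ y, W (θ t y) with hFε
  -- the derivative of `F_ε` along the line, and its bound `≤ C₁ t ≤ C₁ τ` on `[0, τ]`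
  have hderiv : ∀ t ∈ Icc (0 : ℝ) 1, HasDerivWithinAt Fε (∫ y, fderiv ℝ W (θ t y) (B y)) (Icc 0 1) t := by
    intro t ht
    have h := C1Weight.hasDerivWithinAt_integral_comp_fderiv h01 hθ hUo hW1 hmaps ht
    have e : (∫ y, fderiv ℝ W (θ t y) (Torus.timeDerivWithin (Icc 0 1) θ t y)) =
        ∫ y, fderiv ℝ W (θ t y) (B y) :=
      integral_congr_ae (ae_of_all _ fun y => by
        show fderiv ℝ W (θ t y) (Torus.timeDerivWithin (Icc 0 1) θ t y) = fderiv ℝ W (θ t y) (B y)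
        rw [show Torus.timeDerivWithin (Icc 0 1) θ t y = B y from timeDerivWithin_affine A B h01 ht y])
    rw [e] at h
    exact h
  have hDle : ∀ t ∈ Icc (0 : ℝ) 1, (∫ y, fderiv ℝ W (θ t y) (B y)) ≤ C₁ * t := by
    intro t ht
    have hmt : ∀ y, θ t y ∈ posSet φ g := hmaps t ht
    -- `B = Δ(θ t) - t Δ B`
    have hΔθ : ∀ y, Torus.laplacian (θ t) y = B y + t • Torus.laplacian B y := by
      intro y
      have h1 : θ t = A + t • B := by funext z; rfl
      rw [h1]
      have hsm : Torus.IsSmooth (t • B) := hB.const_smul t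
      rw [show Torus.laplacian (A + t • B) y = Torus.laplacian A y + Torus.laplacian (t • B) y from
        Literature.Analysis.FunctionSpaces.Torus.laplacian_add_apply hA hsm y]
      rw [show Torus.laplacian (t • B) y = t • Torus.laplacian B y from
        Literature.Analysis.FunctionSpaces.Torus.laplacian_const_smul_apply hB t y]
    have hsplit : ∀ y, fderiv ℝ W (θ t y) (B y) =
        fderiv ℝ W (θ t y) (Torus.laplacian (θ t) y) - t * fderiv ℝ W (θ t y) (Torus.laplacian B y) := by
      intro y
      rw [hΔθ y, map_add, map_smul, smul_eq_mul]
      ring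
    simp_rw [hsplit]
    have hcL : Continuous fun y => fderiv ℝ W (θ t y) (Torus.laplacian (θ t) y) :=
      ConvexWeight.continuous_fderiv_apply hUo hW2 (hθt t) hmt (hθt t).laplacian.continuous
    have hcB : Continuous fun y => fderiv ℝ W (θ t y) (Torus.laplacian B y) :=
      ConvexWeight.continuous_fderiv_apply hUo hW2 (hθt t) hmt hB.laplacian.continuous
    rw [integral_sub hcL.integrable_unitAddTorus (hcB.integrable_unitAddTorus.const_mul t),
      integral_const_mul]
    -- the viscous sign lemma
    have hvisc : ∫ y, fderiv ℝ W (θ t y) (Torus.laplacian (θ t) y) ≤ 0 :=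
      ConvexWeight.integral_fderiv_laplacian_nonpos hUo hW2 (hθt t) hmt
        fun y w => hessian_weight_nonneg φ hconv hlip hq (hmt y) w
    -- `|∫ DW(θ)[ΔB]| ≤ q (G+3)^{q-1} M`
    have habs : |∫ y, fderiv ℝ W (θ t y) (Torus.laplacian B y)| ≤ q * (G + 3) ^ (q - 1) * M := by
      have hpt : ∀ y, |fderiv ℝ W (θ t y) (Torus.laplacian B y)| ≤ q * (G + 3) ^ (q - 1) * M := by
        intro y
        have h1 := abs_fderiv_weight_apply_le φ hlip hq0.le (hmt y) (Torus.laplacian B y)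
        have hlam : lamReg φ g (θ t y) ≤ G + 3 := by
          have h2 := (lamReg_mem_Icc φ hlip (θ t y)).2
          rw [hr] at h2
          have h3 : g (θ t y) ≤ G := (le_abs_self _).trans (hG t ht y)
          linarith
        have hlam0 : 0 ≤ lamReg φ g (θ t y) := (hmt y).le
        have h4 : lamReg φ g (θ t y) ^ (q - 1) ≤ (G + 3) ^ (q - 1) :=
          Real.rpow_le_rpow hlam0 hlam (by linarith)
        calc |fderiv ℝ W (θ t y) (Torus.laplacian B y)|
            ≤ q * lamReg φ g (θ t y) ^ (q - 1) * ‖Torus.laplacian B y‖ := h1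
          _ ≤ q * (G + 3) ^ (q - 1) * M := by
              refine mul_le_mul (mul_le_mul_of_nonneg_left h4 hq0.le) (hM y) (norm_nonneg _) ?_
              exact mul_nonneg hq0.le (Real.rpow_nonneg (by linarith) _)
      calc |∫ y, fderiv ℝ W (θ t y) (Torus.laplacian B y)|
          ≤ ∫ y, |fderiv ℝ W (θ t y) (Torus.laplacian B y)| := abs_integral_le_integral_abs
        _ ≤ ∫ _y : UnitAddTorus (Fin 3), q * (G + 3) ^ (q - 1) * M :=
            integral_mono hcB.abs.integrable_unitAddTorus (integrable_const _) hpt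
        _ = q * (G + 3) ^ (q - 1) * M := by simp
    have ht0 : 0 ≤ t := ht.1
    have h5 : -(t * ∫ y, fderiv ℝ W (θ t y) (Torus.laplacian B y)) ≤ t * (q * (G + 3) ^ (q - 1) * M) := by
      have := neg_abs_le (∫ y, fderiv ℝ W (θ t y) (Torus.laplacian B y))
      nlinarith [habs, this]
    calc (∫ y, fderiv ℝ W (θ t y) (Torus.laplacian (θ t) y)) -
          t * ∫ y, fderiv ℝ W (θ t y) (Torus.laplacian B y)
        ≤ 0 + t * (q * (G + 3) ^ (q - 1) * M) := by linarith
      _ = C₁ * t := by rw [hC₁]; ring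
  -- mean value inequality on `[0, τ]`
  have hsubε : Fε τ - Fε 0 ≤ C₁ * τ * (τ - 0) := by
    have hcont : ContinuousOn Fε (Icc 0 τ) := fun s hs =>
      (hderiv s ⟨hs.1, hs.2.trans hτ1⟩).continuousWithinAt.mono (Icc_subset_Icc le_rfl hτ1)
    have hdiff : DifferentiableOn ℝ Fε (interior (Icc 0 τ)) := by
      rw [interior_Icc]; intro s hs
      have hs' : s ∈ Icc (0 : ℝ) 1 := ⟨hs.1.le, hs.2.le.trans hτ1⟩
      exact ((hderiv s hs').hasDerivAt (Icc_mem_nhds hs.1 (lt_of_lt_of_le hs.2 hτ1))).differentiableAt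
        |>.differentiableWithinAt
    have hle : ∀ s ∈ interior (Icc 0 τ), deriv Fε s ≤ C₁ * τ := by
      rw [interior_Icc]; intro s hs
      have hs' : s ∈ Icc (0 : ℝ) 1 := ⟨hs.1.le, hs.2.le.trans hτ1⟩
      rw [((hderiv s hs').hasDerivAt (Icc_mem_nhds hs.1 (lt_of_lt_of_le hs.2 hτ1))).deriv]
      exact (hDle s hs').trans (mul_le_mul_of_nonneg_left hs.2.le hC₁0)
    exact (convex_Icc 0 τ).image_sub_le_mul_sub_of_deriv_le hcont hdiff hle 0
      (left_mem_Icc.2 hτ.le) τ (right_mem_Icc.2 hτ.le) hτ.le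
  -- the sandwich `f ≤ F_ε ≤ f + C₂ ε` at the two times
  have hsand : ∀ t ∈ Icc (0 : ℝ) 1, f t ≤ Fε t ∧ Fε t ≤ f t + C₂ * ε := by
    intro t ht
    have hc : Continuous fun y => g (θ t y) := hgc.comp (hθt t).continuous
    have h0 : ∀ y, 0 ≤ g (θ t y) := hg0θ t
    have hGt : ∀ y, g (θ t y) ≤ G := fun y => (le_abs_self _).trans (hG t ht y)
    have hwc : Continuous fun y => W (θ t y) :=
      ((contDiff_lamReg φ hgc).continuous.comp (hθt t).continuous).rpow_const fun _ => Or.inr hq0.le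
    constructor
    · exact integral_mono_of_nonneg (ae_of_all _ fun y => Real.rpow_nonneg (h0 y) _)
        hwc.integrable_unitAddTorus
        (ae_of_all _ fun y => (weight_mem_Icc φ hlip hq0.le (h0 y)).1)
    · have h1 : Fε t ≤ ∫ y, (g (θ t y) + 3 * ε) ^ q := by
        refine integral_mono_of_nonneg (ae_of_all _ fun y => ?_)
          (((hc.add continuous_const).rpow_const fun _ => Or.inr hq0.le).integrable_unitAddTorus)
          (ae_of_all _ fun y => ?_)
        · exact weight_nonneg φ q (mem_posSet_of_nonneg φ hlip (h0 y)).1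
        · have h2 := (weight_mem_Icc φ hlip hq0.le (h0 y)).2
          rw [hr] at h2; exact h2
      have hm := integral_add_rpow_sub_le hc h0 hGt (by positivity : (0 : ℝ) ≤ 3 * ε)
        (by linarith : 3 * ε ≤ 3) hq
      calc Fε t ≤ ∫ y, (g (θ t y) + 3 * ε) ^ q := h1
        _ ≤ f t + q * (G + 3) ^ (q - 1) * (3 * ε) := by linarith
        _ = f t + C₂ * ε := by rw [hC₂]; ring
  obtain ⟨hl1, _⟩ := hsand τ ⟨hτ.le, hτ1⟩
  obtain ⟨_, hu0⟩ := hsand 0 ⟨le_rfl, zero_le_one⟩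
  have e : C₁ * τ * (τ - 0) = C₁ * τ ^ 2 := by ring
  rw [e] at hsubε
  linarith

/-! ## 3. The heat sieve: `0 ≤ heatDissipation`, i.e. rate `0` -/

/-- **The admissible cores pass the heat sieve**: `0 ≤ heatDissipation Φ v` for `Φ = ∫ g(S)^q` (`g`
convex, `1`-Lipschitz, `≥ 0` on divergence-free strains; `q ≥ 1`) and every smooth divergence-free `v`.
[ours; SIEVELD §0/§1 "Jensen", kernel proof via the mollified weight] -/
theorem heatDissipation_nonneg_of_admissible {q : ℝ} (hq : 1 ≤ q)
    {g : EuclideanSpace ℝ (Fin 3 × Fin 3) → ℝ} (hconv : ConvexOn ℝ univ g) (hlip : LipschitzWith 1 g)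
    (hg0 : ∀ v : UnitAddTorus (Fin 3) → EuclideanSpace ℝ (Fin 3), Torus.IsSmooth v →
      Torus.IsDivFree v → ∀ x, 0 ≤ g (strainFlat v x))
    {Φ : (UnitAddTorus (Fin 3) → EuclideanSpace ℝ (Fin 3)) → ℝ}
    (hΦ : ∀ v : UnitAddTorus (Fin 3) → EuclideanSpace ℝ (Fin 3), Torus.IsSmooth v →
      Torus.IsDivFree v → Φ v = ∫ x, g (strainFlat v x) ^ q)
    {v : UnitAddTorus (Fin 3) → EuclideanSpace ℝ (Fin 3)} (hv : Torus.IsSmooth v)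
    (hdiv : Torus.IsDivFree v) : 0 ≤ heatDissipation Φ v := by
  have hgc : Continuous g := hlip.continuous
  -- for every `δ > 0` the quotient at some `τ > 0` exceeds `heatDissipation - δ`; it is `≤ C τ ≤ …`
  obtain ⟨C, hC⟩ := heatLine_sub_le_sq hq hconv hlip hg0 hΦ hv hdiv
  -- convexity and the right derivative
  have hv1 : Torus.IsContDiff 1 v := hv.isContDiff (by simp)
  have hΔ1 : Torus.IsContDiff 1 (Torus.laplacian v) := hv.laplacian.isContDiff (by simp)
  set φ : ℝ → ℝ := fun t => Φ (v + t • Torus.laplacian v) with hφdef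
  have hcvx : ConvexOn ℝ univ φ := by
    have h := convexOn_integral_posPart_rpow_line (d := Fin 3) hconv hgc
      (continuous_strainFlat hv) (continuous_strainFlat hv.laplacian) hq
    refine h.congr fun t _ => ?_
    have hvt : Torus.IsSmooth (v + t • Torus.laplacian v) := isSmooth_heatLine hv t
    have hdt : Torus.IsDivFree (v + t • Torus.laplacian v) :=
      isDivFree_add_smul hv hv.laplacian hdiv (isDivFree_laplacian hv hdiv) t
    show (∫ x, max (g (strainFlat v x + t • strainFlat (Torus.laplacian v) x)) 0 ^ q) = φ t
    rw [hφdef]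
    simp only
    rw [hΦ _ hvt hdt]
    refine integral_congr_ae (ae_of_all _ fun x => ?_)
    show max (g (strainFlat v x + t • strainFlat (Torus.laplacian v) x)) 0 ^ q =
      g (strainFlat (v + t • Torus.laplacian v) x) ^ q
    rw [← strainFlat_add_smul hv1 hΔ1, max_eq_left (hg0 _ hvt hdt x)]
  obtain ⟨hder, heq⟩ := heatDissipation_eq_neg_rightDeriv hcvx
  set D := derivWithin φ (Set.Ioi 0) 0 with hD
  rw [heq]
  -- `D ≤ 0`: the slopes `(φ τ - φ 0)/τ ≤ C τ → 0`
  have ht := (hasDerivWithinAt_iff_tendsto_slope' self_notMem_Ioi).mp hder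
  have hφ0 : φ 0 = Φ v := by simp [hφdef]
  have hev : ∀ᶠ τ in 𝓝[>] (0 : ℝ), slope φ 0 τ ≤ |C| * τ := by
    have hmem : Ioo (0 : ℝ) 1 ∈ 𝓝[>] (0 : ℝ) := Ioo_mem_nhdsGT one_pos
    filter_upwards [hmem] with τ hτ
    rw [slope_def_field, hφ0, sub_zero, div_le_iff₀ hτ.1]
    have h1 := hC τ hτ.1 hτ.2.le
    have h2 : C * τ ^ 2 ≤ |C| * τ ^ 2 := mul_le_mul_of_nonneg_right (le_abs_self C) (sq_nonneg τ)
    calc φ τ - Φ v = Φ (v + τ • Torus.laplacian v) - Φ v := rfl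
      _ ≤ |C| * τ ^ 2 := h1.trans h2
      _ = |C| * τ * τ := by ring
  have hlim : Tendsto (fun τ : ℝ => |C| * τ) (𝓝[>] (0 : ℝ)) (𝓝 0) := by
    have h : Tendsto (fun τ : ℝ => |C| * τ) (𝓝 (0 : ℝ)) (𝓝 (|C| * 0)) :=
      (continuous_const.mul continuous_id).tendsto 0
    rw [mul_zero] at h
    exact h.mono_left nhdsWithin_le_nhds
  have hD0 : D ≤ 0 := le_of_tendsto_of_tendsto ht hlim hev
  linarith

/-- **Row: the `λ₁` core passes the heat sieve — `TopEigHeatCoercive q 0`** for every real `q ≥ 1`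
(`heatCoercive_zero_iff`: rate `0` is the static heat sieve of SIEVELD §1). [ours] -/
theorem topEigHeatCoercive_zero {q : ℝ} (hq : 1 ≤ q) : TopEigHeatCoercive (d := Fin 3) q 0 := by
  intro _ v hv hdiv _
  rw [zero_mul]
  exact heatDissipation_nonneg_of_admissible hq convexOn_lam lipschitzWith_lam
    (fun _ hv hdiv x => lam_strainFlat_nonneg hv hdiv x)
    (fun _ hv hdiv => torusTopEigMoment_eq hv hdiv q) hv hdiv

/-- **Row: the `−λ₃` core passes the heat sieve — `NegBotEigHeatCoercive q 0`** for every real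
`q ≥ 1`. [ours] -/
theorem negBotEigHeatCoercive_zero {q : ℝ} (hq : 1 ≤ q) : NegBotEigHeatCoercive (d := Fin 3) q 0 := by
  intro _ v hv hdiv _
  rw [zero_mul]
  exact heatDissipation_nonneg_of_admissible (g := fun A => lam (-A)) hq convexOn_lam_neg
    lipschitzWith_lam_neg (fun _ hv hdiv x => lam_neg_strainFlat_nonneg hv hdiv x)
    (fun _ hv hdiv => torusNegBotEigMoment_eq hv hdiv q) hv hdiv

end TopEig

end Summit.NavierStokesRegularity.FunctionalMining

end
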